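import Literature.MathematicalPhysics.QuantumFieldTheory.Balaban1983to89.B9Thm31GpDecayOfCoerciveZd
import Literature.MathematicalPhysics.QuantumFieldTheory.Balaban1983to89.B8CubeMemberLevelDisjoint

/-!
# `Balaban1983to89.B9Eq325QprimeStarLowerBoundZd` — [Balaban1985BackgroundPropagators] (3.18)–(3.19) p. 393 «`Q′` is onto» ∕ (3.25) p. 394 ∕ Thm 3.11 p. 416 IN QUANTITATIVE
# CURRENCY AT THE `ℤᵈ × 𝔸` CARRIER: the EXPLICIT LOWER BOUND `‖Q′*φ‖²_τ ≥ (Lᵈ)^{−2m}·⟨φ, φ⟩_τ` for the `τ`-adjoint `Q′*` of the multi-level averaging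
# `Q′ = (𝟙_{Λ_j}Q′_j(U₀))_{j≤m}` under the block-geometry clause `LevelDisjoint L m Λ s` (print's «Λ_j = Ω_j^{(j)} ∖ Ω_{j+1}^{(j)}»), at EVERY background of units
# whose averaged transporters below level `m` are unitary — the second factor of an EXPLICIT coercivity constant `c″ = ((Lᵈ)^{2m}·Θ²)⁻¹` for the third operator
# `Q′G′(U₀)²Q′*` of (3.25) (the first factor `Θ⁻²` is `B9Eq324DeltaPrimeUpperBoundZd.formE_QprimeStar_le_sq_mul_levForm_qggq`; the product is assembled in the
# companion `B9Eq325QGGQCoerciveExplicitZd`) — no compactness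

statement-level skeleton of published theorems with citation tags; proofs where landed; nothing here is a claim about the
Yang–Mills mass gap

`[Balaban1985BackgroundPropagators]` ("B9", CMP **99** (1985) 389–434) p. 393: *«we define Λ_j = Ω_j^{(j)} ∖ Ω_{j+1}^{(j)}, j = 0, 1, …, k, Ω_{k+1} = ∅, or
Ω_j ∖ Ω_{j+1} = Bʲ(Λ_j) … (Q′(U)λ)(y) = Σ_{x∈B(y)} L⁻ᵈ R(U(Γ_{y,x}))λ(x), (3.18) … Q′_j(U) = Q′(Ūʲ⁻¹)⋯Q′(Ū)Q′(U), (3.19)»*; p. 394 (3.25) («(Q′G′²Q′*)⁻¹»); p. 416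
Thm 3.11: *«the operators Δ′_a, G′, (Q′G′²Q′*)⁻¹, Δ_a, G are positive definite. This is obvious for the first three operators»*.  `[Balaban1985Averaging]` Prop. 2
p. 26 (unitarity of the averaged transporters in the small-field window).  The bound is elementary: test `Q′*φ` against the single-site field `δ_x X` at the site
`x ∈ Ω₀` OWNED by a constraint point `p = (j, y)` (`LevelDisjoint`): by adjointness and the single-site formula `(Q′_jδ_xX)(y) = L^{−jd}R(⋯)X` (all other constraint
points blind to `x`) `Re τ((Q′*φ)(x)* X) = Re τ(φ_p* · trIter_j x X)`; choosing `X` with `trIter_j x X = φ_p` (`|X|_τ = (Lᵈ)ʲ|φ_p|_τ` for unitary transporters) and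
Cauchy–Schwarz in the fibre give `|φ_p|_τ ≤ (Lᵈ)ʲ·|(Q′*φ)(x_p)|_τ`; the owned sites are pairwise distinct (blindness), so summing over `𝔅` gives the claim.
PDF held: `paper:balaban1985-cmp99-background-propagators` pp. 393–394, 416 (re-read 2026-08-28).

CITATION HEADER (lean-in-tree rule).  Cell `pub-ymgap` (YM Track A, D-0062 ∕ D-0149), node N06 = [B9], width seat `pub-ymgap-dag-n06-w4` (g5), CLAIM-1 ∕ INTENT-1 — the
piece DESIGNED in g4's HANDOFF («second half of an explicit c″ for STATION 2»).  Inputs BY NAME: this seat's g2 `B9Eq325QprimeSingleSiteZd` (`trIter`, `QprimeIter_single`,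
`trIter_surjective`, `LevelDisjoint`) and `B9Eq325QGGQInvZd` (`levSupp`, `levForm`, `QprimeVec`, `QprimeStar`, `formE_qprimeStar`), dag-n06-w2 g4's `B9Eq342CombesThomasFormZd`
(`fnorm`, `fnorm_smul`, `abs_fibreForm_le`, `formE_self_eq_sum_sq`) and `B9Thm31GpDecayOfCoerciveZd.fnorm_conjR_of_unitary`, dag-n06-b's
`B9Thm311PosDefNearFlatZd.bgT_mem_unitaryUnits_of_reg17UnivP`, dag-n05-c's `B8CubeMemberLevelDisjoint.levelDisjoint_of_subset_cubeLamS`, `B9Thm311PosDefOpenZd.cubeMember_Ω0_finite`.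

WHAT IS PROVED (kernel, 0 sorry; theorems only — no `def`, `instance`, `notation`; faithful Hermitian tracial `τ` a PARAMETER).
* §1 `fnorm_trIter` (`|trIter_j x X|_τ = (Lᵈ)^{−j}·|X|_τ` when the averaged transporters below level `j` are unitary).
* §2 `re_trace_QprimeStar_single` (`Re τ((Q′*φ)(x)* X) = Re τ(φ(j,y)* · trIter_j x X)` at a site `x ∈ Ω₀` owned by `(j, y)`, all other constraint points blind).
* §3 ★ `fnorm_level_le_pow_mul_fnorm_QprimeStar` (`|φ(j,y)|_τ ≤ (Lᵈ)ʲ·|(Q′*φ)(x)|_τ`), `fnorm_level_sq_le`.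
* §4 ★★★ `weighted_levForm_le_formE_QprimeStar` (`Σ_{j≤m} (Lᵈ)^{−2j} Σ_{y∈Λ_j} |φ(j,y)|²_τ ≤ ‖Q′*φ‖²_τ` under `LevelDisjoint`), ★★★ `levForm_self_le_mul_formE_QprimeStar`
  (`⟨φ, φ⟩_τ ≤ (Lᵈ)^{2m}·‖Q′*φ‖²_τ`).
* §5 (readings) ★★ `levForm_self_le_of_reg17UnivP` (the class (1.7) on `ℤᵈ` below `α_Q∕L²` discharges the transporter hypothesis, `L ≥ 2`, `d > 0`),
  ★★ `levForm_self_le_cubeMember` (at a cube member of [Balaban1985RegularSpaces] (1.131) the geometry clause is dag-n05-c's theorem: NO geometric hypothesis displayed,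
  `1 ≤ L ≤ ρ`, `m ≤ k`), `levForm_self_le_one_cubeMember` (A6: the flat background — every transporter is `1`).

HONEST SCOPE.  The constant `(Lᵈ)^{2m}` is EXPLICIT but NOT uniform in the member (one owned site per block is used; print's volume weights on `𝔅` are dropped as in the
sibling files — with the full block geometry the factor improves to `(Lᵈ)^{m}`, a successor piece); `L²_τ` currency, no decay (dag-n06-w2's stations consume the constant);
count-neutral helper (`--supports` the K1 item of record); N05 ∕ N06 NOT discharged; K1 NOT closed; one finite `𝕋⁴` programme at fixed `ε`, Bałaban as printed; R4 closes
only the conditional finite-`𝕋⁴` rung `BalabanLadder.UV` — nothing continuum ∕ ℝ⁴ ∕ OS ∕ mass gap ∕ Clay.  Unit `pub-ymgap-dag-n06-w4` (g5), 2026-08-28.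
-/

noncomputable section

namespace Literature.MathematicalPhysics.QuantumFieldTheory.Balaban1983to89.B9Eq325QprimeStarLowerBoundZd

open B7Prop1Explicit
open B7Eq78Linearization (conjR QprimeIter zdBlocking)
open B7Prop2Explicit (unitaryUnits)
open B8Eq119TwistedAxial (bgT bgT_one)
open B8Eq131CubesAdmissible (cubeFam)
open B8CubeMemberZd (cubeLamS)
open B8LeafModelZd (ZdIdx)
open B8Eq191FlatLettersCubeMember (cubeLamS_finite)
open B9Eq321LandauProjectionZd (suppSub formE formE_apply)
open B9Eq324DeltaPrimeAZd (single)
open B9Eq325QGGQInvZd (levSupp levForm levForm_apply QprimeVec QprimeVec_apply_of_mem QprimeStar formE_qprimeStar)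
open B9Eq325QprimeSingleSiteZd (blockMapIter trIter trIter_zero trIter_succ QprimeIter_single trIter_surjective LevelDisjoint
  qprimeStarInjective_of_levelDisjoint)
open B9Eq342CombesThomasFormZd (fnorm fnorm_nonneg fnorm_sq fnorm_smul abs_fibreForm_le formE_self_eq_sum_sq)
open B9Thm31GpDecayOfCoerciveZd (fnorm_conjR_of_unitary)
open B9Eq316AveragingTransposeZd (Reg17 alphaQ)
open B9Thm311PosDefNearFlatZd (bgT_mem_unitaryUnits_of_reg17UnivP)
open B9Thm311PosDefOpenZd (cubeMember_Ω0_finite)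
open B8CubeMemberLevelDisjoint (levelDisjoint_of_subset_cubeLamS)

-- `Site` alone could resolve to the torus sites of `Setup.lean`; re-export the `ℤ^d` sites of `B7Prop1Explicit`.
export B7Prop1Explicit (Site)

variable {d : ℕ} {𝔸 : Type*} [CStarAlgebra 𝔸]
variable (τ : 𝔸 →ₗ[ℂ] ℂ) (hτp : ∀ a : 𝔸, a ≠ 0 → 0 < (τ (star a * a)).re)
  (hτt : ∀ a b : 𝔸, τ (a * b) = τ (b * a)) (hτs : ∀ a : 𝔸, τ (star a) = starRingEnd ℂ (τ a))

/-! ## §1  The fibre transport is a weighted isometry for `|·|_τ` -/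

section Transport

variable {L : ℕ} {U₀ : Site d → Fin d → 𝔸ˣ}

include hτt in
/-- **`|trIter_j x X|_τ = (Lᵈ)^{−j}·|X|_τ`** when the averaged transporters `Ū₀^{j′}(Γ)`, `j′ < j`, are unitary: each step of the fibre transport (3.19) is `L⁻ᵈ` times a
conjugation by a unitary. [cite: Balaban1985BackgroundPropagators, (3.18)–(3.19) p.393; Balaban1985Averaging, Prop. 2 p.26] -/
theorem fnorm_trIter (x : Site d) (X : 𝔸) :
    ∀ j : ℕ, (∀ j', j' < j → ∀ z y : Site d, bgT L U₀ j' z y ∈ unitaryUnits 𝔸) →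
      fnorm τ (trIter L U₀ j x X) = (((L : ℝ) ^ d)⁻¹) ^ j * fnorm τ X := by
  intro j
  induction j with
  | zero =>
    intro _
    rw [trIter_zero, pow_zero, one_mul]
  | succ j ih =>
    intro hT
    have hLd : (0 : ℝ) ≤ ((L : ℝ) ^ d)⁻¹ := by positivity
    rw [trIter_succ, fnorm_smul, fnorm_conjR_of_unitary τ hτt (hT j (Nat.lt_succ_self j) _ _),
      ih (fun j' hj' => hT j' (Nat.lt_succ_of_lt hj')), abs_of_nonneg hLd, pow_succ]
    ring

end Transport

/-! ## §2  Testing `Q′*φ` against a single-site field at an owned site -/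

section Test

variable [FiniteDimensional ℝ 𝔸] {L : ℕ} [NeZero L] (U₀ : Site d → Fin d → 𝔸ˣ) {m : ℕ} {Λ : ℕ → Finset (Site d)} {s : Finset (Site d)}

omit [FiniteDimensional ℝ 𝔸] [NeZero L] in
/-- the single-site field `δ_x X` lies in `L²(Ω₀, ·)` for `x ∈ Ω₀`. [cite: Balaban1985BackgroundPropagators, (3.21) p.394 (bookkeeping)] -/
theorem single_mem_suppSub {x : Site d} (hxs : x ∈ s) (X : 𝔸) : single x X ∈ suppSub (𝔸 := 𝔸) s := by
  intro z hz
  have hzx : z ≠ x := fun h => hz (h ▸ hxs)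
  simp [single, hzx]

include hτs in
/-- **`Re τ((Q′*φ)(x)* X) = Re τ(φ(j,y)* · trIter_j x X)`** for a site `x ∈ Ω₀` in the level-`j` block of the constraint point `(j, y)` (`blockMap^[j] x = y`) to which every
OTHER constraint point is blind: adjointness `⟨Q′*φ, δ_xX⟩_{Ω₀} = ⟨φ, Q′δ_xX⟩_𝔅` and the single-site formula `(Q′_iδ_xX)(y′) = 𝟙[blockMap^[i] x = y′]·trIter_i x X`.
[cite: Balaban1985BackgroundPropagators, (3.18)–(3.19) p.393, (3.25) p.394 («Q′*»), p.391 («The adjoints …»)] -/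
theorem re_trace_QprimeStar_single (φ : levSupp (𝔸 := 𝔸) m Λ) {j : ℕ} {y : Site d} (hj : j ∈ Finset.range (m + 1)) (hy : y ∈ Λ j)
    {x : Site d} (hxs : x ∈ s) (hxy : blockMapIter L j x = y)
    (hblind : ∀ i ∈ Finset.range (m + 1), ∀ y' ∈ Λ i, (i, y') ≠ (j, y) → blockMapIter L i x ≠ y') (X : 𝔸) :
    (τ (star ((QprimeStar L U₀ τ m Λ s hτp φ : Site d → 𝔸) x) * X)).re =
      (τ (star ((φ : ℕ × Site d → 𝔸) (j, y)) * trIter L U₀ j x X)).re := by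
  classical
  have h := formE_qprimeStar L U₀ τ m Λ s hτp hτs φ ⟨single x X, single_mem_suppSub hxs X⟩
  -- left side: only the site `x` contributes
  have hL : formE τ s (QprimeStar L U₀ τ m Λ s hτp φ) ⟨single x X, single_mem_suppSub hxs X⟩ =
      (τ (star ((QprimeStar L U₀ τ m Λ s hτp φ : Site d → 𝔸) x) * X)).re := by
    rw [formE_apply, Finset.sum_eq_single_of_mem x hxs]
    · show (τ (star ((QprimeStar L U₀ τ m Λ s hτp φ : Site d → 𝔸) x) * single x X x)).re = _
      simp [single]
    · intro z _ hzx
      show (τ (star ((QprimeStar L U₀ τ m Λ s hτp φ : Site d → 𝔸) z) * single x X z)).re = 0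
      simp [single, hzx]
  -- right side: only the constraint point `(j, y)` contributes
  have hR : levForm τ m Λ φ (QprimeVec L U₀ m Λ s ⟨single x X, single_mem_suppSub hxs X⟩) =
      (τ (star ((φ : ℕ × Site d → 𝔸) (j, y)) * trIter L U₀ j x X)).re := by
    rw [levForm_apply, Finset.sum_eq_single_of_mem j hj (fun i hi hij => ?_)]
    · rw [Finset.sum_eq_single_of_mem y hy (fun y' hy' hyy => ?_)]
      · rw [QprimeVec_apply_of_mem L U₀ m Λ s _ hj hy]
        show (τ (star ((φ : ℕ × Site d → 𝔸) (j, y)) * QprimeIter (zdBlocking d L) (bgT L U₀) j (single x X) y)).re = _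
        rw [QprimeIter_single L U₀ x X j y, if_pos hxy]
      · rw [QprimeVec_apply_of_mem L U₀ m Λ s _ hj hy']
        show (τ (star ((φ : ℕ × Site d → 𝔸) (j, y')) * QprimeIter (zdBlocking d L) (bgT L U₀) j (single x X) y')).re = 0
        rw [QprimeIter_single L U₀ x X j y', if_neg (hblind j hj y' hy' fun h' => hyy (Prod.ext_iff.1 h').2), mul_zero, map_zero,
          Complex.zero_re]
    · refine Finset.sum_eq_zero fun y' hy' => ?_
      rw [QprimeVec_apply_of_mem L U₀ m Λ s _ hi hy']
      show (τ (star ((φ : ℕ × Site d → 𝔸) (i, y')) * QprimeIter (zdBlocking d L) (bgT L U₀) i (single x X) y')).re = 0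
      rw [QprimeIter_single L U₀ x X i y', if_neg (hblind i hi y' hy' fun h' => hij (Prod.ext_iff.1 h').1), mul_zero, map_zero,
        Complex.zero_re]
  rw [← hL, h, hR]

end Test

/-! ## §3  The pointwise bound `|φ(j,y)|_τ ≤ (Lᵈ)ʲ·|(Q′*φ)(x)|_τ` at an owned site -/

section Pointwise

variable [FiniteDimensional ℝ 𝔸] {L : ℕ} [NeZero L] (U₀ : Site d → Fin d → 𝔸ˣ) {m : ℕ} {Λ : ℕ → Finset (Site d)} {s : Finset (Site d)}

include hτt hτs in
/-- ★ **`|φ(j,y)|_τ ≤ (Lᵈ)ʲ·|(Q′*φ)(x)|_τ`** at a site `x ∈ Ω₀` owned by the constraint point `(j, y)` (in its `j`-block, all other constraint points blind), when the averaged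
transporters below level `j` are unitary: with `trIter_j x X = φ(j,y)` (`|X|_τ = (Lᵈ)ʲ|φ(j,y)|_τ`), `|φ(j,y)|²_τ = Re τ((Q′*φ)(x)* X) ≤ |(Q′*φ)(x)|_τ·|X|_τ`.
[cite: Balaban1985BackgroundPropagators, (3.18)–(3.19) p.393, (3.25) p.394; Balaban1985Averaging, Prop. 2 p.26] -/
theorem fnorm_level_le_pow_mul_fnorm_QprimeStar (φ : levSupp (𝔸 := 𝔸) m Λ) {j : ℕ} {y : Site d} (hj : j ∈ Finset.range (m + 1)) (hy : y ∈ Λ j)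
    (hT : ∀ j', j' < j → ∀ z y : Site d, bgT L U₀ j' z y ∈ unitaryUnits 𝔸)
    {x : Site d} (hxs : x ∈ s) (hxy : blockMapIter L j x = y)
    (hblind : ∀ i ∈ Finset.range (m + 1), ∀ y' ∈ Λ i, (i, y') ≠ (j, y) → blockMapIter L i x ≠ y') :
    fnorm τ ((φ : ℕ × Site d → 𝔸) (j, y)) ≤ ((L : ℝ) ^ d) ^ j * fnorm τ ((QprimeStar L U₀ τ m Λ s hτp φ : Site d → 𝔸) x) := by
  set a := (φ : ℕ × Site d → 𝔸) (j, y) with ha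
  set b := (QprimeStar L U₀ τ m Λ s hτp φ : Site d → 𝔸) x with hb
  obtain ⟨X, hX⟩ := trIter_surjective L U₀ (NeZero.ne L) x j a
  have hL0 : (0 : ℝ) < (L : ℝ) := by exact_mod_cast Nat.pos_of_ne_zero (NeZero.ne L)
  have hLd : (0 : ℝ) < (L : ℝ) ^ d := pow_pos hL0 d
  -- `|a|_τ = (Lᵈ)^{-j} |X|_τ`
  have hfa : fnorm τ a = (((L : ℝ) ^ d)⁻¹) ^ j * fnorm τ X := by
    rw [← hX]
    exact fnorm_trIter τ hτt x X j hT
  have hfX : fnorm τ X = ((L : ℝ) ^ d) ^ j * fnorm τ a := by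
    rw [hfa, ← mul_assoc, ← mul_pow, mul_inv_cancel₀ hLd.ne', one_pow, one_mul]
  -- `|a|²_τ = Re τ(b* X) ≤ |b|_τ |X|_τ`
  have hsq : fnorm τ a ^ 2 ≤ fnorm τ b * fnorm τ X := by
    have h1 : (τ (star a * a)).re = (τ (star b * X)).re := by
      rw [hb, re_trace_QprimeStar_single τ hτp hτs U₀ φ hj hy hxs hxy hblind X, hX]
    rw [fnorm_sq hτp, h1]
    exact (le_abs_self _).trans (abs_fibreForm_le hτp hτs b X)
  rw [hfX] at hsq
  by_cases h0 : fnorm τ a = 0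
  · rw [h0]
    exact mul_nonneg (pow_nonneg hLd.le j) (fnorm_nonneg τ b)
  · have hpos : 0 < fnorm τ a := lt_of_le_of_ne (fnorm_nonneg τ a) (Ne.symm h0)
    have h2 : fnorm τ a * fnorm τ a ≤ (((L : ℝ) ^ d) ^ j * fnorm τ b) * fnorm τ a := by
      rw [← sq]
      calc fnorm τ a ^ 2 ≤ fnorm τ b * (((L : ℝ) ^ d) ^ j * fnorm τ a) := hsq
        _ = (((L : ℝ) ^ d) ^ j * fnorm τ b) * fnorm τ a := by ring
    exact le_of_mul_le_mul_right h2 hpos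

include hτt hτs in
/-- **`|φ(j,y)|²_τ ≤ (Lᵈ)^{2j}·|(Q′*φ)(x)|²_τ`** at an owned site (squared form of the previous bound).
[cite: Balaban1985BackgroundPropagators, (3.18)–(3.19) p.393, (3.25) p.394] -/
theorem fnorm_level_sq_le (φ : levSupp (𝔸 := 𝔸) m Λ) {j : ℕ} {y : Site d} (hj : j ∈ Finset.range (m + 1)) (hy : y ∈ Λ j)
    (hT : ∀ j', j' < j → ∀ z y : Site d, bgT L U₀ j' z y ∈ unitaryUnits 𝔸)
    {x : Site d} (hxs : x ∈ s) (hxy : blockMapIter L j x = y)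
    (hblind : ∀ i ∈ Finset.range (m + 1), ∀ y' ∈ Λ i, (i, y') ≠ (j, y) → blockMapIter L i x ≠ y') :
    fnorm τ ((φ : ℕ × Site d → 𝔸) (j, y)) ^ 2 ≤ (((L : ℝ) ^ d) ^ j) ^ 2 * fnorm τ ((QprimeStar L U₀ τ m Λ s hτp φ : Site d → 𝔸) x) ^ 2 := by
  have h := fnorm_level_le_pow_mul_fnorm_QprimeStar τ hτp hτt hτs U₀ φ hj hy hT hxs hxy hblind
  calc fnorm τ ((φ : ℕ × Site d → 𝔸) (j, y)) ^ 2 ≤ (((L : ℝ) ^ d) ^ j * fnorm τ ((QprimeStar L U₀ τ m Λ s hτp φ : Site d → 𝔸) x)) ^ 2 :=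
      pow_le_pow_left₀ (fnorm_nonneg τ _) h 2
    _ = (((L : ℝ) ^ d) ^ j) ^ 2 * fnorm τ ((QprimeStar L U₀ τ m Λ s hτp φ : Site d → 𝔸) x) ^ 2 := by rw [mul_pow]

end Pointwise

/-! ## §4  Summing over the constraint set: `‖Q′*φ‖²_τ ≥ (Lᵈ)^{−2m}·⟨φ, φ⟩_τ` under `LevelDisjoint` -/

section Sum

variable [FiniteDimensional ℝ 𝔸] {L : ℕ} [NeZero L] (U₀ : Site d → Fin d → 𝔸ˣ) (m : ℕ) (Λ : ℕ → Finset (Site d)) (s : Finset (Site d))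

include hτt hτs in
/-- ★★★ **THE WEIGHTED LOWER BOUND `Σ_{j≤m} (Lᵈ)^{−2j} Σ_{y∈Λ_j} |φ(j,y)|²_τ ≤ ‖Q′*φ‖²_τ`** under `LevelDisjoint L m Λ s`, for EVERY background of units whose averaged
transporters below level `m` are unitary: each constraint point is bounded at its owned site (§3), the owned sites are pairwise distinct (a shared site would be seen by
both points), and `Σ_{x} |(Q′*φ)(x)|²_τ` over distinct sites is at most `‖Q′*φ‖²_τ`. [cite: Balaban1985BackgroundPropagators, (3.18)–(3.19) p.393 («Λ_j = Ω_j^{(j)} ∖ Ω_{j+1}^{(j)}»), (3.25) p.394; Balaban1985Averaging, Prop. 2 p.26] -/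
theorem weighted_levForm_le_formE_QprimeStar (hT : ∀ j', j' < m → ∀ z y : Site d, bgT L U₀ j' z y ∈ unitaryUnits 𝔸)
    (h : LevelDisjoint L m Λ s) (φ : levSupp (𝔸 := 𝔸) m Λ) :
    ∑ j ∈ Finset.range (m + 1), ((((L : ℝ) ^ d) ^ j) ^ 2)⁻¹ * ∑ y ∈ Λ j, fnorm τ ((φ : ℕ × Site d → 𝔸) (j, y)) ^ 2 ≤
      formE τ s (QprimeStar L U₀ τ m Λ s hτp φ) (QprimeStar L U₀ τ m Λ s hτp φ) := by
  classical
  set g : Site d → 𝔸 := (QprimeStar L U₀ τ m Λ s hτp φ : Site d → 𝔸) with hg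
  -- the owned sites
  have hch : ∀ p : ℕ × Site d, p.1 ∈ Finset.range (m + 1) ∧ p.2 ∈ Λ p.1 → ∃ x ∈ s, blockMapIter L p.1 x = p.2 ∧
      ∀ i ∈ Finset.range (m + 1), ∀ y' ∈ Λ i, (i, y') ≠ (p.1, p.2) → blockMapIter L i x ≠ y' := fun p hp => h p.1 hp.1 p.2 hp.2
  let site : ℕ × Site d → Site d := fun p =>
    if hp : p.1 ∈ Finset.range (m + 1) ∧ p.2 ∈ Λ p.1 then Classical.choose (hch p hp) else p.2
  have hsite : ∀ p : ℕ × Site d, (hp : p.1 ∈ Finset.range (m + 1) ∧ p.2 ∈ Λ p.1) → site p ∈ s ∧ blockMapIter L p.1 (site p) = p.2 ∧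
      ∀ i ∈ Finset.range (m + 1), ∀ y' ∈ Λ i, (i, y') ≠ (p.1, p.2) → blockMapIter L i (site p) ≠ y' := by
    intro p hp
    have hc := Classical.choose_spec (hch p hp)
    have hs : site p = Classical.choose (hch p hp) := by simp only [site, dif_pos hp]
    rw [hs]
    exact ⟨hc.1, hc.2.1, hc.2.2⟩
  -- the constraint set `𝔅` as a finset of `ℕ × ℤᵈ`
  set B : Finset (ℕ × Site d) := (Finset.range (m + 1)).biUnion fun j => (Λ j).image (Prod.mk j) with hB
  have hmemB : ∀ p : ℕ × Site d, p ∈ B ↔ p.1 ∈ Finset.range (m + 1) ∧ p.2 ∈ Λ p.1 := by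
    intro p
    simp only [hB, Finset.mem_biUnion, Finset.mem_image]
    constructor
    · rintro ⟨j, hj, y, hy, rfl⟩
      exact ⟨hj, hy⟩
    · rintro ⟨hj, hy⟩
      exact ⟨p.1, hj, p.2, hy, rfl⟩
  -- the owned sites are pairwise distinct on `𝔅`
  have hinj : ∀ p ∈ B, ∀ q ∈ B, site p = site q → p = q := by
    intro p hp q hq hpq
    rw [hmemB] at hp hq
    by_contra hne
    have hne' : (q.1, q.2) ≠ (p.1, p.2) := fun h' => hne (Prod.ext (Prod.ext_iff.1 h').1.symm (Prod.ext_iff.1 h').2.symm)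
    have h1 := (hsite p hp).2.2 q.1 hq.1 q.2 hq.2 hne'
    rw [hpq] at h1
    exact h1 (hsite q hq).2.1
  -- the weighted level sum as a sum over `𝔅`
  have hdisj : (↑(Finset.range (m + 1)) : Set ℕ).PairwiseDisjoint (fun j => (Λ j).image (Prod.mk j)) := by
    intro j₁ _ j₂ _ hne
    rw [Function.onFun, Finset.disjoint_left]
    intro p hp₁ hp₂
    rw [Finset.mem_image] at hp₁ hp₂
    obtain ⟨y₁, _, rfl⟩ := hp₁
    obtain ⟨y₂, _, h2⟩ := hp₂
    exact hne (Prod.ext_iff.1 h2).1.symm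
  have hLHS : ∑ j ∈ Finset.range (m + 1), ((((L : ℝ) ^ d) ^ j) ^ 2)⁻¹ * ∑ y ∈ Λ j, fnorm τ ((φ : ℕ × Site d → 𝔸) (j, y)) ^ 2 =
      ∑ p ∈ B, ((((L : ℝ) ^ d) ^ p.1) ^ 2)⁻¹ * fnorm τ ((φ : ℕ × Site d → 𝔸) p) ^ 2 := by
    rw [hB, Finset.sum_biUnion hdisj]
    refine Finset.sum_congr rfl fun j _ => ?_
    rw [Finset.sum_image fun y _ y' _ h' => (Prod.ext_iff.1 h').2, Finset.mul_sum]
  -- the pointwise bound at each constraint point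
  have hL0 : (0 : ℝ) < (L : ℝ) := by exact_mod_cast Nat.pos_of_ne_zero (NeZero.ne L)
  have hpt : ∀ p ∈ B, ((((L : ℝ) ^ d) ^ p.1) ^ 2)⁻¹ * fnorm τ ((φ : ℕ × Site d → 𝔸) p) ^ 2 ≤ fnorm τ (g (site p)) ^ 2 := by
    intro p hp
    rw [hmemB] at hp
    obtain ⟨hxs, hxy, hbl⟩ := hsite p hp
    have hjm : p.1 ≤ m := Nat.lt_succ_iff.1 (Finset.mem_range.1 hp.1)
    have h3 := fnorm_level_sq_le τ hτp hτt hτs U₀ φ hp.1 hp.2 (fun j' hj' => hT j' (lt_of_lt_of_le hj' hjm)) hxs hxy hbl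
    have hLp : (0 : ℝ) < (((L : ℝ) ^ d) ^ p.1) ^ 2 := by positivity
    calc ((((L : ℝ) ^ d) ^ p.1) ^ 2)⁻¹ * fnorm τ ((φ : ℕ × Site d → 𝔸) p) ^ 2
        ≤ ((((L : ℝ) ^ d) ^ p.1) ^ 2)⁻¹ * ((((L : ℝ) ^ d) ^ p.1) ^ 2 * fnorm τ (g (site p)) ^ 2) :=
          mul_le_mul_of_nonneg_left h3 (inv_nonneg.2 hLp.le)
      _ = fnorm τ (g (site p)) ^ 2 := by rw [← mul_assoc, inv_mul_cancel₀ hLp.ne', one_mul]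
  -- the owned sites lie in `Ω₀`
  have himg : B.image site ⊆ s := by
    intro x hx
    rw [Finset.mem_image] at hx
    obtain ⟨p, hp, rfl⟩ := hx
    exact (hsite p ((hmemB p).1 hp)).1
  -- sum over `𝔅`, then over the distinct owned sites
  calc ∑ j ∈ Finset.range (m + 1), ((((L : ℝ) ^ d) ^ j) ^ 2)⁻¹ * ∑ y ∈ Λ j, fnorm τ ((φ : ℕ × Site d → 𝔸) (j, y)) ^ 2
      = ∑ p ∈ B, ((((L : ℝ) ^ d) ^ p.1) ^ 2)⁻¹ * fnorm τ ((φ : ℕ × Site d → 𝔸) p) ^ 2 := hLHS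
    _ ≤ ∑ p ∈ B, fnorm τ (g (site p)) ^ 2 := Finset.sum_le_sum hpt
    _ = ∑ x ∈ B.image site, fnorm τ (g x) ^ 2 := (Finset.sum_image (f := fun x => fnorm τ (g x) ^ 2) hinj).symm
    _ ≤ ∑ x ∈ s, fnorm τ (g x) ^ 2 := Finset.sum_le_sum_of_subset_of_nonneg himg fun x _ _ => sq_nonneg _
    _ = formE τ s (QprimeStar L U₀ τ m Λ s hτp φ) (QprimeStar L U₀ τ m Λ s hτp φ) := (formE_self_eq_sum_sq hτp _).symm

include hτt hτs in
/-- ★★★ **`⟨φ, φ⟩_τ ≤ (Lᵈ)^{2m}·‖Q′*φ‖²_τ` — THE QUANTITATIVE «`Q′` IS ONTO»**: under `LevelDisjoint L m Λ s`, for EVERY background of units `U₀` whose averaged transporters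
below level `m` are unitary, the `τ`-adjoint `Q′*` of the multi-level averaging is bounded below on `L²(𝔅, ·)` with the EXPLICIT constant `(Lᵈ)^{−2m}`.
[cite: Balaban1985BackgroundPropagators, (3.18)–(3.19) p.393, (3.25) p.394, Thm 3.11 p.416 («(Q′G′²Q′*)⁻¹ … positive definite. This is obvious»); Balaban1985Averaging, Prop. 2 p.26] -/
theorem levForm_self_le_mul_formE_QprimeStar (hT : ∀ j', j' < m → ∀ z y : Site d, bgT L U₀ j' z y ∈ unitaryUnits 𝔸)
    (h : LevelDisjoint L m Λ s) (φ : levSupp (𝔸 := 𝔸) m Λ) :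
    levForm τ m Λ φ φ ≤ (((L : ℝ) ^ d) ^ m) ^ 2 * formE τ s (QprimeStar L U₀ τ m Λ s hτp φ) (QprimeStar L U₀ τ m Λ s hτp φ) := by
  have hw := weighted_levForm_le_formE_QprimeStar τ hτp hτt hτs U₀ m Λ s hT h φ
  have hL0 : (0 : ℝ) < (L : ℝ) := by exact_mod_cast Nat.pos_of_ne_zero (NeZero.ne L)
  have hL1 : (1 : ℝ) ≤ (L : ℝ) ^ d := one_le_pow₀ (by exact_mod_cast Nat.one_le_iff_ne_zero.2 (NeZero.ne L))
  have hA : (0 : ℝ) < (((L : ℝ) ^ d) ^ m) ^ 2 := by positivity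
  -- `(Lᵈ)^{-2m}·⟨φ, φ⟩_τ ≤` the weighted sum
  have key : ((((L : ℝ) ^ d) ^ m) ^ 2)⁻¹ * levForm τ m Λ φ φ ≤
      ∑ j ∈ Finset.range (m + 1), ((((L : ℝ) ^ d) ^ j) ^ 2)⁻¹ * ∑ y ∈ Λ j, fnorm τ ((φ : ℕ × Site d → 𝔸) (j, y)) ^ 2 := by
    rw [levForm_apply, Finset.mul_sum]
    refine Finset.sum_le_sum fun j hj => ?_
    have hjm : j ≤ m := Nat.lt_succ_iff.1 (Finset.mem_range.1 hj)
    rw [Finset.sum_congr rfl fun y _ => (fnorm_sq hτp ((φ : ℕ × Site d → 𝔸) (j, y))).symm]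
    refine mul_le_mul_of_nonneg_right ?_ (Finset.sum_nonneg fun _ _ => sq_nonneg _)
    have hjpos : (0 : ℝ) < (((L : ℝ) ^ d) ^ j) ^ 2 := by positivity
    exact inv_anti₀ hjpos (pow_le_pow_left₀ (by positivity) (pow_le_pow_right₀ hL1 hjm) 2)
  calc levForm τ m Λ φ φ = (((L : ℝ) ^ d) ^ m) ^ 2 * (((((L : ℝ) ^ d) ^ m) ^ 2)⁻¹ * levForm τ m Λ φ φ) := by
        rw [← mul_assoc, mul_inv_cancel₀ hA.ne', one_mul]
    _ ≤ (((L : ℝ) ^ d) ^ m) ^ 2 * ∑ j ∈ Finset.range (m + 1), ((((L : ℝ) ^ d) ^ j) ^ 2)⁻¹ * ∑ y ∈ Λ j, fnorm τ ((φ : ℕ × Site d → 𝔸) (j, y)) ^ 2 :=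
        mul_le_mul_of_nonneg_left key hA.le
    _ ≤ (((L : ℝ) ^ d) ^ m) ^ 2 * formE τ s (QprimeStar L U₀ τ m Λ s hτp φ) (QprimeStar L U₀ τ m Λ s hτp φ) :=
        mul_le_mul_of_nonneg_left hw hA.le

end Sum

/-! ## §5  Readings: the class (1.7) on `ℤᵈ`; cube members; the flat background -/

section Readings

variable [FiniteDimensional ℝ 𝔸] {L : ℕ} [NeZero L]

include hτt hτs in
/-- ★★ **ON THE CLASS (1.7) ON `ℤᵈ` BELOW `α_Q∕L²`** (`L ≥ 2`, `d > 0`, unitary `U₀`): `⟨φ, φ⟩_τ ≤ (Lᵈ)^{2m}·‖Q′*φ‖²_τ` under `LevelDisjoint`, the transporter hypothesis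
discharged by dag-n06-b's `bgT_mem_unitaryUnits_of_reg17UnivP`. [cite: Balaban1985BackgroundPropagators, (3.18)–(3.19) p.393, (3.25) p.394; Balaban1985Averaging, Prop. 2 p.26; Balaban1985RegularSpaces, (1.7) p.77] -/
theorem levForm_self_le_of_reg17UnivP [Nontrivial 𝔸] (hd : 0 < d) (hL : 2 ≤ L) (m : ℕ) (Λ : ℕ → Finset (Site d)) (s : Finset (Site d))
    {U₀ : Site d → Fin d → 𝔸ˣ} (hU : ∀ (x : Site d) (κ : Fin d), U₀ x κ ∈ unitaryUnits 𝔸)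
    (hreg : Reg17 L m (fun _ => (Set.univ : Set (Site d))) (alphaQ d L / (L : ℝ) ^ 2) U₀) (h : LevelDisjoint L m Λ s) (φ : levSupp (𝔸 := 𝔸) m Λ) :
    levForm τ m Λ φ φ ≤ (((L : ℝ) ^ d) ^ m) ^ 2 * formE τ s (QprimeStar L U₀ τ m Λ s hτp φ) (QprimeStar L U₀ τ m Λ s hτp φ) :=
  levForm_self_le_mul_formE_QprimeStar τ hτp hτt hτs U₀ m Λ s
    (fun j' hj' => bgT_mem_unitaryUnits_of_reg17UnivP hd hL m hU hreg j' hj'.le) h φ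

include hτt hτs in
/-- ★★ **AT A CUBE MEMBER, NO GEOMETRIC HYPOTHESIS IS LEFT**: with `Λ_j` the truncated constraint classes `cubeLamS` of the cube tower of [Balaban1985RegularSpaces] (1.131)
and `s = □₀ = i.Ω 0`, the clause `LevelDisjoint` is dag-n05-c's `levelDisjoint_of_subset_cubeLamS` (`1 ≤ L ≤ ρ`, `m ≤ k`), so for EVERY background of units `U₀` whose
averaged transporters below level `m` are unitary: `⟨φ, φ⟩_τ ≤ (Lᵈ)^{2m}·‖Q′*φ‖²_τ` on the member's level data.
[cite: Balaban1985BackgroundPropagators, (3.18)–(3.19) p.393, (3.25) p.394, Thm 3.11 p.416; Balaban1985RegularSpaces, (1.131) p.99] -/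
theorem levForm_self_le_cubeMember (i : ZdIdx d L) {a : Site d} {Mc ρ : ℕ} (hΩ : i.Ω = cubeFam false L a Mc ρ i.k) (hρ : L ≤ ρ) {m : ℕ} (hm : m ≤ i.k)
    (U₀ : Site d → Fin d → 𝔸ˣ) (hT : ∀ j', j' < m → ∀ (z y : Site d), bgT L U₀ j' z y ∈ unitaryUnits 𝔸)
    (φ : levSupp (𝔸 := 𝔸) m (fun j => (cubeLamS_finite L a Mc ρ i.k m j).toFinset)) :
    levForm τ m (fun j => (cubeLamS_finite L a Mc ρ i.k m j).toFinset) φ φ ≤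
      (((L : ℝ) ^ d) ^ m) ^ 2 *
        formE τ (cubeMember_Ω0_finite i hΩ).toFinset
          (QprimeStar L U₀ τ m (fun j => (cubeLamS_finite L a Mc ρ i.k m j).toFinset) (cubeMember_Ω0_finite i hΩ).toFinset hτp φ)
          (QprimeStar L U₀ τ m (fun j => (cubeLamS_finite L a Mc ρ i.k m j).toFinset) (cubeMember_Ω0_finite i hΩ).toFinset hτp φ) := by
  have hL1 : 1 ≤ L := Nat.one_le_iff_ne_zero.2 (NeZero.ne L)
  have hs : cubeFam false L a Mc ρ i.k 0 ⊆ ↑((cubeMember_Ω0_finite i hΩ).toFinset) := by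
    rw [Set.Finite.coe_toFinset, hΩ]
  have hΛ : ∀ j, j ≤ m → ∀ y ∈ (cubeLamS_finite L a Mc ρ i.k m j).toFinset, y ∈ cubeLamS L a Mc ρ i.k m j :=
    fun j _ y hy => (Set.Finite.mem_toFinset _).1 hy
  exact levForm_self_le_mul_formE_QprimeStar τ hτp hτt hτs U₀ m _ _ hT (levelDisjoint_of_subset_cubeLamS hL1 a Mc hρ hm hΛ hs) φ

include hτt hτs in
/-- **A6 ∕ NON-VACUITY AT THE CUBE MEMBER — THE FLAT BACKGROUND** (`U₀ = 1`: every averaged transporter is `1`, `bgT_one`): the bound holds with no hypothesis left.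
[cite: Balaban1985BackgroundPropagators, (3.18)–(3.19) p.393, Thm 3.11 p.416; Balaban1985RegularSpaces, (1.131) p.99] -/
theorem levForm_self_le_one_cubeMember (i : ZdIdx d L) {a : Site d} {Mc ρ : ℕ} (hΩ : i.Ω = cubeFam false L a Mc ρ i.k) (hρ : L ≤ ρ) {m : ℕ} (hm : m ≤ i.k)
    (φ : levSupp (𝔸 := 𝔸) m (fun j => (cubeLamS_finite L a Mc ρ i.k m j).toFinset)) :
    levForm τ m (fun j => (cubeLamS_finite L a Mc ρ i.k m j).toFinset) φ φ ≤
      (((L : ℝ) ^ d) ^ m) ^ 2 *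
        formE τ (cubeMember_Ω0_finite i hΩ).toFinset
          (QprimeStar L (1 : Site d → Fin d → 𝔸ˣ) τ m (fun j => (cubeLamS_finite L a Mc ρ i.k m j).toFinset) (cubeMember_Ω0_finite i hΩ).toFinset hτp φ)
          (QprimeStar L (1 : Site d → Fin d → 𝔸ˣ) τ m (fun j => (cubeLamS_finite L a Mc ρ i.k m j).toFinset) (cubeMember_Ω0_finite i hΩ).toFinset hτp φ) :=
  levForm_self_le_cubeMember τ hτp hτt hτs i hΩ hρ hm 1
    (fun j _ z y => show bgT L (1 : Site d → Fin d → 𝔸ˣ) j z y ∈ unitaryUnits 𝔸 by rw [bgT_one]; exact (unitaryUnits 𝔸).one_mem) φ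

end Readings

end Literature.MathematicalPhysics.QuantumFieldTheory.Balaban1983to89.B9Eq325QprimeStarLowerBoundZd

end
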